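import Literature.Topology.FourManifolds.HCobordismWallSpinCase
import Literature.Topology.FourManifolds.LatticeFormsEichlerFrames
import Literature.Topology.FourManifolds.WallDiffeomorphismsProofs
import HarnessLib

/-!
# Wall's Theorem 2 from the realisation of Kirby's generators of ONE summand (no generation theorem)

Topic `Literature/Topology/FourManifolds`; fact seat of
`Literature.Topology.FourManifolds.isHCobordant_of_equivalent_intersectionForm` (**C. T. C. Wall,
*On simply-connected 4-manifolds*, J. London Math. Soc. 39 (1964) 141–149, Thm. 2**); sequel of
`HCobordismKirby.lean` and `LatticeFormsEichlerFrames.lean`.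

`HCobordismKirby.lean` proves Wall's Theorem 2 for a pair with a common stabilisation from Kirby's
Thm. X.2 (`isHCobordant_of_isStabilization_of_thmX2`) and isolates what the regluing takes from
the diffeomorphism theory (`isHCobordant_of_isStabilization_of_realisedOnFrames`, hypothesis
`hT`: a diffeomorphism-realised automorphism agreeing with Kirby's isometry `A` on the `N`-side
hyperbolic frame).  Kirby's proof of Thm. X.2 (LNM 1374, pp. 61–62) has two halves: (R) the
generators `A_a`, `A'_a` (handle slides of the `S² × S²` summand) and `1 ⊕ O(H)` (diffeomorphisms
of `S² × S²`) are realised by diffeomorphisms of `X # S² × S²`; (G) they generate `O(Q_X ⊕ H)`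
(Wall 1962/1963).  This file proves that **(R) alone gives `hT`, hence Wall's Theorem 2, for every
pair whose form contains a hyperbolic plane** (every pair with even indefinite forms, by the
classification; every pair with odd forms containing `⟨1⟩ ⊕ ⟨-1⟩ ⊕ ⟨±1⟩`, e.g. the Akhmedov–Park
form `⟨1⟩ ⊕ 2⟨-1⟩`): the subgroup generated by the generators of the LAST summand of
`P # S² × S² # S² × S²` acts transitively enough on hyperbolic frames by the Eichler criterion
(`exists_isWordIn_wallGenerators_apply_eq_of_frame`, GHS 2009 Prop. 3.3 (i), (ii) — elementary),
the spare hyperbolic plane needed by the last Eichler step being the one of the core `Q_M`.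

* `isRealisedByDiffeomorph_conj_of_isWordIn` — a word in realised (conjugated) generators is
  realised (`WallDiffeomorphismsProofs.lean` packaging);
* `isHCobordant_of_isStabilization_of_realisedWallGenerators` — **Wall's Thm. 2 for a pair with a
  common stabilisation and a hyperbolic plane in `Q_M`, from the realisation hypothesis `hR`**:
  for `X` simply connected closed smooth with `Q_X` indefinite or of rank `≤ 8`,
  `Y = X # S² × S²`, an orientation `υ` of `Y` and an isometry `Q_X ⊕ H ≅ Q_Y` (a witness that one
  exists), SOME isometry `Θ : Q_X ⊕ H ≅ Q_Y` has all conjugated Kirby generators `Θ s Θ⁻¹`,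
  `s ∈ wallGenerators`, realised by diffeomorphisms of `Y` — Kirby p. 61 "it is not hard to see
  that `A_w`, `A'_w` and `1 ⊕ g` are realised by diffeomorphisms"; this is the X.2 seats'
  interface `hS` of `forall_isRealisedByDiffeomorph_of_forall_mem_wallGenerators`
  (`WallDiffeomorphismsGeneration.lean`) quantified over the connected sums, and it follows from
  Thm. X.2 itself (`realisedWallGenerators_of_thmX2`); it is an explicit hypothesis `hR`, not a
  named fact;
* the X.2 road factors through `hR`: `isHCobordant_of_isStabilization_of_realisedWallGenerators
  (realisedWallGenerators_of_thmX2 h2)` re-derives `isHCobordant_of_isStabilization_of_thmX2`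
  (`HCobordismKirby.lean`) for cores with a hyperbolic plane, so `hR` is weaker than X.2 (no
  separate declaration: the unrestricted theorem is `isHCobordant_of_isStabilization_of_thmX2`);
* §4: Wall's Thm. 2 for cores with a hyperbolic plane from `hR` and a common stabilisation —
  `isHCobordant_of_realisedWallGenerators_of_thmX3` (+ Kirby X.3),
  `isHCobordant_of_equivalent_intersectionForm_of_not_isEven_of_realisedWallGenerators` (odd
  forms: + Thom only), `…_of_evenBordism_of_realisedWallGenerators` (+ Thom + the spin bordism
  step for even forms).

Everything is proved; no named fact is introduced. NOT covered: cores without a hyperbolic plane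
(`Q_M` definite, or `≅ ⟨1⟩ ⊕ ⟨-1⟩`, or `0`), where the last Eichler step has no spare plane and
(G) is genuinely needed (or, for `Q_M = 0`, the realised `1 ⊕ O(H)`).

## References

* R. C. Kirby, *The topology of 4-manifolds*, LNM 1374 (1989), Ch. X, proof of Thm. 1
  (pp. 55–56) and of Thm. 2 (pp. 61–62). [Kirby1989]
* C. T. C. Wall, *On simply-connected 4-manifolds*, J. London Math. Soc. 39 (1964) 141–149,
  Thm. 2, §2, p. 145. [WallJLMS1964]
* V. Gritsenko, K. Hulek, G. K. Sankaran, J. Algebra 322 (2009) 463–478, Prop. 3.3.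
  [GritsenkoHulekSankaran2009]
-/

noncomputable section

open scoped Manifold ContDiff Topology ContinuousMap
open Set Function Topology CategoryTheory CategoryTheory.Limits Module
open Literature.AlgebraicTopology.SingularHomology Literature.AlgebraicTopology.Homotopy
open LinearMap.BilinForm
open LinearMap (BilinForm)

namespace Literature.Topology.FourManifolds

/-- Local notation: `𝔼 n` is the model Euclidean space `EuclideanSpace ℝ (Fin n)`. -/
local notation "𝔼 " n:arg => EuclideanSpace ℝ (Fin n)

/-- Local notation: `𝕊 n` is the unit sphere in `EuclideanSpace ℝ (Fin (n + 1))`. -/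
local notation "𝕊 " n:arg => (Metric.sphere (0 : EuclideanSpace ℝ (Fin (n + 1))) 1)

/-- Local notation: `Q⟦μ⟧` is the intersection form on `H²(·; ℤ)/T`. -/
local notation "Q⟦" μ "⟧" =>
  Literature.AlgebraicTopology.SingularHomology.intersectionForm two_add_two_eq_four μ

/-! ### §1 Words in realised generators are realised -/

section Realise

variable {Y : Type} [TopologicalSpace Y] [ChartedSpace (𝔼 4) Y]

/-- **A word in Kirby's generators, conjugated by the identification `Θ : Q ⊕ H ≅ Q_Y`, is
realised by a diffeomorphism as soon as the conjugated generators are** (closure of the realised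
automorphisms under products and inverses, `isRealisedByDiffeomorph_of_forall_mem`).
[cite: Kirby1989, Ch. X, proof of Thm. 2 (pp. 61–62)] -/
theorem isRealisedByDiffeomorph_conj_of_isWordIn (υ : HomologicalOrientation ℤ Y 4)
    {V : Type*} [AddCommGroup V] {Q : BilinForm ℤ V} (hQ : Q.IsSymm)
    (Θ : (Q.prod hyperbolicForm).IsometryEquiv (Q⟦υ⟧))
    (hS : ∀ s ∈ wallGenerators hQ, IsRealisedByDiffeomorph υ (Θ.symm.trans (s.trans Θ)))
    {φ : (Q.prod hyperbolicForm).IsometryEquiv (Q.prod hyperbolicForm)}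
    (hφ : IsWordIn (wallGenerators hQ) φ) :
    IsRealisedByDiffeomorph υ (Θ.symm.trans (φ.trans Θ)) := by
  obtain ⟨l, hl, hlφ⟩ := hφ
  obtain ⟨f, hf⟩ := isRealisedByDiffeomorph_of_forall_mem υ
    {B | ∃ s ∈ wallGenerators hQ, B = Θ.symm.trans (s.trans Θ)}
    (by
      rintro B ⟨s, hs, rfl⟩
      exact hS s hs)
    (l.map fun ψ => Θ.symm.trans (ψ.trans Θ))
    (by
      intro B hB
      obtain ⟨ψ, hψ, rfl⟩ := List.mem_map.1 hB
      rcases hl ψ hψ with h | h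
      · exact Or.inl ⟨ψ, h, rfl⟩
      · refine Or.inr ⟨ψ.symm, h, DFunLike.ext _ _ fun v => ?_⟩
        simp)
  refine ⟨f, fun x => (hf x).trans ?_⟩
  change wordProd (l.map fun ψ => Θ.symm.trans (ψ.trans Θ)) x = Θ (φ (Θ.symm x))
  rw [wordProd_map_conj_apply]
  exact congrArg Θ (hlφ (Θ.symm x))

end Realise

/-! ### §2 The one-fold stabilisation form as an isometry `Q_X ⊕ H ≅ Q_Y` -/

section OneFold

variable {X Y : Type} [TopologicalSpace X] [TopologicalSpace Y]

/-- **An identification `Q ⊕ H ≅ Q_Y` from one-fold stabilisation data**: the additive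
equivalence `Θ : H²(X)/T × (ℤ²)¹ ≃ H²(Y)/T` carrying the form to `Q⟦μ_X⟧ ⊥ H`
(`exists_stabilisationCobordism 1`), preceded by an identification `g : (V, Q) ≅ (H²(X)/T, Q_X)`
of an abstract lattice with `Q_X` and by `ℤ² = (ℤ²)¹`, is a linear isometry `Q ⊕ H ≅ Q⟦μ_Y⟧`.
(The abstract copy `V` — in practice coordinates with respect to a basis — is what the lattice
lemmas, stated for the canonical `ℤ`-module structure of an additive group, apply to.)
[folklore] -/
theorem nonempty_isometryEquiv_of_stabilisationForm_one (μX : HomologicalOrientation ℤ X 4)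
    (μY : HomologicalOrientation ℤ Y 4)
    (Θ : (↥(freeCohomology ℤ X 2) × (Fin 1 → Fin 2 → ℤ)) ≃+ ↥(freeCohomology ℤ Y 2))
    (hΘ : ∀ x y, Q⟦μY⟧ (Θ x) (Θ y) = Q⟦μX⟧ x.1 y.1 + ∑ j, hyperbolicForm (x.2 j) (y.2 j))
    {V : Type} [AddCommGroup V] (Q : BilinForm ℤ V) (g : V ≃+ ↥(freeCohomology ℤ X 2))
    (hg : ∀ a b, Q⟦μX⟧ (g a) (g b) = Q a b) :
    Nonempty ((Q.prod hyperbolicForm).IsometryEquiv (Q⟦μY⟧)) := by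
  -- `g` and `ℤ² ≃ (ℤ²)¹`, then `Θ`
  let ι : (V × (Fin 2 → ℤ)) ≃+ (↥(freeCohomology ℤ X 2) × (Fin 1 → Fin 2 → ℤ)) :=
    AddEquiv.prodCongr g (LinearEquiv.funUnique (Fin 1) ℤ (Fin 2 → ℤ)).symm.toAddEquiv
  have hι : ∀ x, ι x = (g x.1, fun _ => x.2) := fun x => rfl
  let Aeq : (V × (Fin 2 → ℤ)) ≃+ ↥(freeCohomology ℤ Y 2) := ι.trans Θ
  have hAeq : ∀ x y, Q⟦μY⟧ (Aeq x) (Aeq y) = Q.prod hyperbolicForm x y := fun x y => by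
    change Q⟦μY⟧ (Θ (ι x)) (Θ (ι y)) = _
    rw [hΘ, hι, hι, LinearMap.BilinForm.prod_apply, Fin.sum_univ_one, hg]
  -- as a linear isometry (every additive map of the lattice is `ℤ`-linear)
  let L : (V × (Fin 2 → ℤ)) ≃ₗ[ℤ] ↥(freeCohomology ℤ Y 2) :=
    { Aeq with
      map_smul' := fun c x => by
        simpa only [Int.cast_id, RingHom.id_apply, AddEquiv.coe_toAddMonoidHom,
          AddEquiv.toFun_eq_coe] using map_intCast_smul Aeq.toAddMonoidHom ℤ ℤ c x }
  have hL : ∀ x, L x = Aeq x := fun x => rfl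
  have hmap : ∀ x y, Q⟦μY⟧ (L x) (L y) = Q.prod hyperbolicForm x y := fun x y => by
    rw [hL, hL, hAeq]
  exact ⟨{ L with map_app' := hmap }⟩

end OneFold

/-! ### §3 Wall's Theorem 2 from the realisation of the generators of one summand -/

section Main

/-- **Thm. X.2 gives the realisation hypothesis (R)** of
`isHCobordant_of_isStabilization_of_realisedWallGenerators` below (trivially: every automorphism
of `Q_Y` is realised, and `Θ = Θ₀`) — so (R) is implied by X.2. The hypothesis (R) itself
(Kirby 1989, Ch. X, proof of Thm. 2, p. 61: "Let `x` and `y` also denote the obvious embedded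
2-spheres … it is not hard to see that these automorphisms [`A_w`, `A'_w`] can be realised by
diffeomorphisms … the automorphisms of `H` … are realised by the obvious diffeomorphisms of
`S² × S²` connect sum the identity on `N`") reads, with the binders of Thm. X.2
(`exists_diffeomorph_freeCohomologyMap_eq_of_isometryEquiv`): for `X` simply connected closed
smooth with `Q_X` indefinite or of rank `≤ 8`, `Y = X # S² × S²`, an orientation `υ` of `Y`, any
symmetric lattice `(V, Q)` isometric to `Q_X` (an abstract copy, e.g. coordinates in a basis:
the lattice lemmas are stated for the canonical `ℤ`-module structure of an additive group) and a
witness that `Q ⊕ H ≅ Q_Y` at all, SOME isometry `Θ : Q ⊕ H ≅ Q_Y` has every conjugated Kirby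
generator `Θ⁻¹ s Θ` (`s ∈ wallGenerators`: `A_a`, `A'_a`, `1 ⊕ g`) realised by a diffeomorphism
of `Y` — the hypothesis `hS` of `forall_isRealisedByDiffeomorph_of_forall_mem_wallGenerators`
(`WallDiffeomorphismsGeneration.lean`) quantified over the connected sums. It is kept as an
explicit hypothesis (no named fact).
[cite: Kirby1989, Ch. X, Thm. 2 (p. 59) and proof (p. 61)] -/
theorem realisedWallGenerators_of_thmX2
    (h2 : exists_diffeomorph_freeCohomologyMap_eq_of_isometryEquiv) :
    ∀ (X : Type) [TopologicalSpace X] [T2Space X] [SecondCountableTopology X]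
      [ChartedSpace (𝔼 4) X] [CompactSpace X] [IsManifold (𝓡 4) ∞ X] [SimplyConnectedSpace X]
      (ξ : HomologicalOrientation ℤ X 4)
      (_hX : (Q⟦ξ⟧).IsIndefinite ∨ Module.finrank ℤ ↥(freeCohomology ℤ X 2) ≤ 8)
      (Y : Type) [TopologicalSpace Y] [T2Space Y] [SecondCountableTopology Y]
      [ChartedSpace (𝔼 4) Y] [CompactSpace Y] [IsManifold (𝓡 4) ∞ Y]
      (_hY : IsConnectedSum (𝓡 4) (𝓡 4) ((𝓡 2).prod (𝓡 2)) X ((𝕊 2) × (𝕊 2)) Y)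
      (υ : HomologicalOrientation ℤ Y 4) (V : Type) [AddCommGroup V] (Q : BilinForm ℤ V)
      (hQ : Q.IsSymm) (_e : Q.IsometryEquiv (Q⟦ξ⟧))
      (_Θ₀ : (Q.prod hyperbolicForm).IsometryEquiv (Q⟦υ⟧)),
      ∃ Θ : (Q.prod hyperbolicForm).IsometryEquiv (Q⟦υ⟧),
        ∀ s ∈ wallGenerators hQ, IsRealisedByDiffeomorph υ (Θ.symm.trans (s.trans Θ)) :=
  fun X _ _ _ _ _ _ _ ξ hX Y _ _ _ _ _ _ hY υ _ _ _ _ _ Θ₀ =>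
    ⟨Θ₀, fun s _ => h2 X ξ hX Y hY υ (Θ₀.symm.trans (s.trans Θ₀))⟩

set_option maxHeartbeats 800000 in
/-- **Wall's Theorem 2 for a pair with a common stabilisation and a hyperbolic plane in the form,
from the realisation (R) of Kirby's generators of ONE `S² × S²` summand — no generation theorem
for `O(Q ⊕ H)`** (Kirby 1989, Ch. X, proof of Thm. 1, pp. 55–56; Wall 1964, §2, p. 145).
If `M`, `N` are simply connected closed smooth 4-manifolds with `Q⟦μ⟧ ≅ Q⟦ν⟧`, `Q⟦μ⟧` contains a
hyperbolic pair (`e·e = f·f = 0`, `e·f = 1`), and `P` is a common `k`-fold stabilisation, then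
`M` and `N` are h-cobordant, GIVEN the realisation hypothesis (R) `hR` (see
`realisedWallGenerators_of_thmX2` for its reading; it is implied by Thm. X.2).  Proof: as
`isHCobordant_of_isStabilization_of_realisedOnFrames` — two more stabilisations
`P₁ = P # S² × S²`, `P₂ = P₁ # S² × S²`, the two halves of the stabilisation cobordisms with
their lattice data `Θ_M, Θ_N : Q ⊥ (k+2) H ≅ Q_{P₂}`, Kirby's isometry `A`
(`exists_isometryEquiv_swap`) — but the realised automorphism `A'` agreeing with `A` on the
`N`-side frame `(Θ_N (0, e_l ⊗ (1,0)))_l` is now PRODUCED: (R) for `P₂ = P₁ # S² × S²` gives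
`Θ : Q_{P₁} ⊕ H ≅ Q_{P₂}` with realised conjugated generators; in `Q_{P₁} ⊕ H` the `k + 1`
hyperbolic planes of `Q_{P₁} ≅ Q⟦±μ⟧ ⊥ (k+1) H` together with `H` are `k + 2` pairwise orthogonal
target planes and the hyperbolic pair of `Q⟦±μ⟧` is a spare one, so
`exists_isWordIn_wallGenerators_apply_eq_of_frame` yields a word `φ` in the generators with
`φ = Θ⁻¹ A Θ` on the pulled-back frame, and `A' = Θ φ Θ⁻¹` is realised
(`isRealisedByDiffeomorph_conj_of_isWordIn`); then Kirby's regluing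
(`isHCobordant_of_regluingData`). [cite: Kirby1989, Ch. X, proof of Thm. 1, pp. 55–56]
[cite: WallJLMS1964, Thm. 2, §2, p. 145] [cite: GritsenkoHulekSankaran2009, Prop. 3.3 (i), (ii)] -/
theorem isHCobordant_of_isStabilization_of_realisedWallGenerators
    (hR : ∀ (X : Type) [TopologicalSpace X] [T2Space X] [SecondCountableTopology X]
      [ChartedSpace (𝔼 4) X] [CompactSpace X] [IsManifold (𝓡 4) ∞ X] [SimplyConnectedSpace X]
      (ξ : HomologicalOrientation ℤ X 4)
      (_hX : (Q⟦ξ⟧).IsIndefinite ∨ Module.finrank ℤ ↥(freeCohomology ℤ X 2) ≤ 8)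
      (Y : Type) [TopologicalSpace Y] [T2Space Y] [SecondCountableTopology Y]
      [ChartedSpace (𝔼 4) Y] [CompactSpace Y] [IsManifold (𝓡 4) ∞ Y]
      (_hY : IsConnectedSum (𝓡 4) (𝓡 4) ((𝓡 2).prod (𝓡 2)) X ((𝕊 2) × (𝕊 2)) Y)
      (υ : HomologicalOrientation ℤ Y 4) (V : Type) [AddCommGroup V] (Q : BilinForm ℤ V)
      (hQ : Q.IsSymm) (_e : Q.IsometryEquiv (Q⟦ξ⟧))
      (_Θ₀ : (Q.prod hyperbolicForm).IsometryEquiv (Q⟦υ⟧)),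
      ∃ Θ : (Q.prod hyperbolicForm).IsometryEquiv (Q⟦υ⟧),
        ∀ s ∈ wallGenerators hQ, IsRealisedByDiffeomorph υ (Θ.symm.trans (s.trans Θ)))
    {M N : Type} [TopologicalSpace M] [T2Space M] [SecondCountableTopology M]
    [ChartedSpace (𝔼 4) M] [CompactSpace M] [IsManifold (𝓡 4) ∞ M] [SimplyConnectedSpace M]
    [TopologicalSpace N] [T2Space N] [SecondCountableTopology N]
    [ChartedSpace (𝔼 4) N] [CompactSpace N] [IsManifold (𝓡 4) ∞ N] [SimplyConnectedSpace N]
    (μ : HomologicalOrientation ℤ M 4) (ν : HomologicalOrientation ℤ N 4)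
    (hQ : (Q⟦μ⟧).Equivalent (Q⟦ν⟧))
    (hcore : ∃ e f : ↥(freeCohomology ℤ M 2), Q⟦μ⟧ e e = 0 ∧ Q⟦μ⟧ f f = 0 ∧ Q⟦μ⟧ e f = 1)
    {k : ℕ} {P : Type} [TopologicalSpace P] [T2Space P] [ChartedSpace (𝔼 4) P]
    [IsManifold (𝓡 4) ∞ P] (hM : IsStabilization k M P) (hN : IsStabilization k N P) :
    IsHCobordant 4 M N := by
  classical
  haveI : SimplyConnectedSpace P := (exists_stabilisationCobordism k M P hM).1
  -- two more stabilisations `P₁ = P # S² × S²`, `P₂ = P₁ # S² × S²`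
  obtain ⟨C₁, -, -⟩ := StdChart.exists_mem_source (Classical.arbitrary P)
  have hM₁ : IsStabilization (k + 1) M C₁.Top := hM.succ C₁.isConnectedSum_top
  have hN₁ : IsStabilization (k + 1) N C₁.Top := hN.succ C₁.isConnectedSum_top
  obtain ⟨hsc₁, hc₁, hsnd₁, hdataM₁⟩ := exists_stabilisationCobordism (k + 1) M C₁.Top hM₁
  haveI := hsc₁
  haveI := hc₁
  haveI := hsnd₁
  obtain ⟨C₂, -, -⟩ := StdChart.exists_mem_source (Classical.arbitrary C₁.Top)
  have hM₂ : IsStabilization (k + 2) M C₂.Top := hM₁.succ C₂.isConnectedSum_top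
  have hN₂ : IsStabilization (k + 2) N C₂.Top := hN₁.succ C₂.isConnectedSum_top
  obtain ⟨hsc₂, hc₂, hsnd₂, hdataM₂⟩ := exists_stabilisationCobordism (k + 2) M C₂.Top hM₂
  obtain ⟨-, -, -, hdataN₂⟩ := exists_stabilisationCobordism (k + 2) N C₂.Top hN₂
  haveI := hsc₂
  haveI := hc₂
  haveI := hsnd₂
  -- `P₂` as a one-fold stabilisation of `P₁`: orientations `μ₂`, `μ₁` with `Q⟦μ₁⟧ ⊕ H ≅ Q⟦μ₂⟧`
  have h1 : IsStabilization 1 C₁.Top C₂.Top :=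
    ((isStabilization_zero_iff C₁.Top C₁.Top).2 ⟨Diffeomorph.refl (𝓡 4) C₁.Top ∞⟩).succ
      C₂.isConnectedSum_top
  obtain ⟨-, -, -, hdata1⟩ := exists_stabilisationCobordism 1 C₁.Top C₂.Top h1
  obtain ⟨μ₂⟩ := isOrientableOver_of_simplyConnectedSpace ℤ C₂.Top (n := 4)
  obtain ⟨μ₁₀⟩ := isOrientableOver_of_simplyConnectedSpace ℤ C₁.Top (n := 4)
  obtain ⟨-, -, Θone, -, μ₁, -, -, -, -, -, -, -, hΘone⟩ := hdata1 μ₁₀ μ₂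
  -- the two halves with their lattice data
  obtain ⟨EM, bM, ΘM, εM, μ', hEMsc, hEMepi, hμ', hεM, hM1, hM2, hM3, hM4⟩ := hdataM₂ μ μ₂
  obtain ⟨EN, bN, ΘN, εN, ν', hENsc, hENepi, hν', hεN, hN1, hN2, hN3, hN4⟩ := hdataN₂ ν μ₂
  -- the isometry of the ends and Kirby's automorphism `A`
  obtain ⟨φ⟩ := equivalent_of_stabilisationForms μ ν hQ hμ' hν' μ₂ ΘM hM4 ΘN hN4
  obtain ⟨A, hA⟩ := exists_isometryEquiv_swap μ' ν' μ₂ ΘM hM4 ΘN hN4 φ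
  -- `Q_{P₁} ≅ Q⟦μ''⟧ ⊥ (k+1) H` is indefinite
  obtain ⟨-, -, Θ₁, -, μ'', -, -, hμ'', -, -, -, -, hM4₁⟩ := hdataM₁ μ μ₁
  have hindef : (Q⟦μ₁⟧).IsIndefinite := isIndefinite_of_stabilisationForm μ'' μ₁ Θ₁ hM4₁
  have hQ₁ : (Q⟦μ₁⟧).IsSymm :=
    isSymm_intersectionForm (cupProduct_gradedComm_holds ℤ C₁.Top) even_two two_add_two_eq_four μ₁
  /- an abstract copy `(V, Q)` of the lattice `Q_{P₁}` (coordinates in a basis, as an opaque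
  additive group): the lattice lemmas are stated for the canonical `ℤ`-module structure of an
  additive group, and on an opaque `V` all instance paths are syntactic (cheap to check). -/
  haveI : Module.Finite ℤ ↥(freeCohomology ℤ C₁.Top 2) :=
    finite_freeCohomology (finite_singularCohomology_of_compactSpace_of_isPrincipalIdealRing ℤ C₁.Top 4 2)
  haveI : Module.Free ℤ ↥(freeCohomology ℤ C₁.Top 2) :=
    free_freeCohomology (finite_singularCohomology_of_compactSpace_of_isPrincipalIdealRing ℤ C₁.Top 4 2)
  obtain ⟨V, instV, g, Q, hQg⟩ : ∃ (V : Type) (_ : AddCommGroup V)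
      (g : V ≃+ ↥(freeCohomology ℤ C₁.Top 2)) (Q : BilinForm ℤ V), ∀ a b, Q a b = Q⟦μ₁⟧ (g a) (g b) :=
    ⟨(Module.Free.ChooseBasisIndex ℤ ↥(freeCohomology ℤ C₁.Top 2) → ℤ), inferInstance,
      (Module.Free.chooseBasis ℤ ↥(freeCohomology ℤ C₁.Top 2)).equivFun.symm.toAddEquiv,
      (Q⟦μ₁⟧).comp (Module.Free.chooseBasis ℤ ↥(freeCohomology ℤ C₁.Top 2)).equivFun.symm.toLinearMap
        (Module.Free.chooseBasis ℤ ↥(freeCohomology ℤ C₁.Top 2)).equivFun.symm.toLinearMap,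
      fun a b => LinearMap.BilinForm.comp_apply _ _ _ a b⟩
  have hQe : ∀ a b, Q (g.symm a) (g.symm b) = Q⟦μ₁⟧ a b := fun a b => by
    simp only [hQg, AddEquiv.apply_symm_apply]
  have hQ' : Q.IsSymm := ⟨fun a b => by simp only [hQg]; exact hQ₁.eq _ _⟩
  -- `g` is `ℤ`-linear for the module structures at hand; the isometry `(V, Q) ≅ Q_{P₁}`
  let L : V ≃ₗ[ℤ] ↥(freeCohomology ℤ C₁.Top 2) :=
    { g with
      map_smul' := fun c x => by
        simpa only [Int.cast_id, RingHom.id_apply, AddEquiv.coe_toAddMonoidHom,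
          AddEquiv.toFun_eq_coe] using map_intCast_smul g.toAddMonoidHom ℤ ℤ c x }
  have hL : ∀ x, L x = g x := fun x => rfl
  let eIso : Q.IsometryEquiv (Q⟦μ₁⟧) :=
    { L with
      map_app' := fun a b => by
        change Q⟦μ₁⟧ (g a) (g b) = Q a b
        exact (hQg a b).symm }
  obtain ⟨Θ₀⟩ := nonempty_isometryEquiv_of_stabilisationForm_one μ₁ μ₂ Θone hΘone Q g
    fun a b => (hQg a b).symm
  -- (R) for `P₂ = P₁ # S² × S²`
  obtain ⟨Θ, hSΘ⟩ := hR C₁.Top μ₁ (Or.inl hindef) C₂.Top C₂.isConnectedSum_top μ₂ V Q hQ' eIso Θ₀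
  /- the lattice `Q ⊕ H`: `k + 2` target planes (the `k + 1` planes of `Q_{P₁}` and `H`)
  and the spare plane (the hyperbolic pair of the core `Q⟦μ''⟧`) -/
  have hB : (Q.prod hyperbolicForm).IsSymm := hQ'.prod isSymm_hyperbolicForm
  -- the planes of `Q_{P₁}`
  have hvv : ∀ (a b : Fin 2) (i j : Fin (k + 1)),
      Q.prod hyperbolicForm ((g.symm (Θ₁ (0, Pi.single i (Pi.single a 1))), 0))
          ((g.symm (Θ₁ (0, Pi.single j (Pi.single b 1))), 0)) =
        if i = j then hyperbolicForm (Pi.single a 1 : Fin 2 → ℤ) (Pi.single b 1) else 0 := by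
    intro a b i j
    simp only [prod_hyperbolic_inl_inl, hQe, hM4₁, LinearMap.map_zero₂, zero_add,
      sum_hyperbolicForm_single_single]
  -- the spare plane
  have hneg : Q⟦-μ⟧ = -Q⟦μ⟧ :=
    intersectionForm_neg (HomologicalOrientation.fundamentalClass_neg_holds ℤ M 4)
      two_add_two_eq_four μ
  obtain ⟨e₀, f₀, he₀, hf₀, hef₀⟩ :
      ∃ e₀ f₀ : ↥(freeCohomology ℤ M 2), Q⟦μ''⟧ e₀ e₀ = 0 ∧ Q⟦μ''⟧ f₀ f₀ = 0 ∧ Q⟦μ''⟧ e₀ f₀ = 1 := by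
    obtain ⟨e, f, he, hf, hef⟩ := hcore
    rcases hμ'' with h | h
    · exact ⟨e, f, h ▸ he, h ▸ hf, h ▸ hef⟩
    · refine ⟨e, -f, ?_, ?_, ?_⟩ <;> simp [h, hneg, he, hf, hef]
  have hsp : ∀ a b : ↥(freeCohomology ℤ M 2),
      Q.prod hyperbolicForm ((g.symm (Θ₁ (a, 0))), 0) ((g.symm (Θ₁ (b, 0))), 0) = Q⟦μ''⟧ a b := by
    intro a b
    simp only [prod_hyperbolic_inl_inl, hQe, hM4₁, Pi.zero_apply, LinearMap.map_zero₂,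
      Finset.sum_const_zero, add_zero]
  have hspv : ∀ (a : ↥(freeCohomology ℤ M 2)) (c : Fin 2) (j : Fin (k + 1)),
      Q.prod hyperbolicForm ((g.symm (Θ₁ (a, 0))), 0)
        ((g.symm (Θ₁ (0, Pi.single j (Pi.single c 1)))), 0) = 0 := by
    intro a c j
    simp [hQe, hM4₁]
  have h₀ : TwoHyperbolicPairs (Q.prod hyperbolicForm) hypX hypY ((g.symm (Θ₁ (e₀, 0))), 0)
      ((g.symm (Θ₁ (f₀, 0))), 0) :=
    twoHyperbolicPairs_prod_hyperbolic hQ'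
      (by simpa only [prod_hyperbolic_inl_inl, he₀] using hsp e₀ e₀)
      (by simpa only [prod_hyperbolic_inl_inl, hf₀] using hsp f₀ f₀)
      (by simpa only [prod_hyperbolic_inl_inl, hef₀] using hsp e₀ f₀)
  -- the `k + 2` target planes (opaque functions with their defining equations)
  obtain ⟨xs, hxs_cast, hxs_last⟩ : ∃ xs : Fin (k + 2) → V × (Fin 2 → ℤ),
      (∀ j : Fin (k + 1), xs j.castSucc = ((g.symm (Θ₁ (0, Pi.single j (Pi.single 0 1)))), 0)) ∧
        xs (Fin.last (k + 1)) = hypX :=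
    ⟨Fin.lastCases hypX fun j => ((g.symm (Θ₁ (0, Pi.single j (Pi.single 0 1)))), 0),
      fun j => by simp, by simp⟩
  obtain ⟨ys, hys_cast, hys_last⟩ : ∃ ys : Fin (k + 2) → V × (Fin 2 → ℤ),
      (∀ j : Fin (k + 1), ys j.castSucc = ((g.symm (Θ₁ (0, Pi.single j (Pi.single 1 1)))), 0)) ∧
        ys (Fin.last (k + 1)) = hypY :=
    ⟨Fin.lastCases hypY fun j => ((g.symm (Θ₁ (0, Pi.single j (Pi.single 1 1)))), 0),
      fun j => by simp, by simp⟩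
  have hxx : ∀ i j, Q.prod hyperbolicForm (xs i) (xs j) = 0 := by
    intro i j
    induction i using Fin.lastCases with
    | last =>
      induction j using Fin.lastCases with
      | last => simp only [hxs_last, prod_hyperbolic_hypX_hypX]
      | cast j => simp only [hxs_last, hxs_cast, prod_hyperbolic_hypX_inl]
    | cast i =>
      induction j using Fin.lastCases with
      | last => simp only [hxs_cast, hxs_last, prod_hyperbolic_inl_hypX]
      | cast j => simp only [hxs_cast, hvv, hyperbolicForm_single_zero_self, ite_self]
  have hyy : ∀ i j, Q.prod hyperbolicForm (ys i) (ys j) = 0 := by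
    intro i j
    induction i using Fin.lastCases with
    | last =>
      induction j using Fin.lastCases with
      | last => simp only [hys_last, prod_hyperbolic_hypY_hypY]
      | cast j => simp only [hys_last, hys_cast, prod_hyperbolic_hypY_inl]
    | cast i =>
      induction j using Fin.lastCases with
      | last => simp only [hys_cast, hys_last, prod_hyperbolic_inl_hypY]
      | cast j => simp only [hys_cast, hvv, hyperbolicForm_single_one_self, ite_self]
  have hxy : ∀ i j, Q.prod hyperbolicForm (xs i) (ys j) = if i = j then 1 else 0 := by
    intro i j
    induction i using Fin.lastCases with
    | last =>
      induction j using Fin.lastCases with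
      | last => simp only [hxs_last, hys_last, prod_hyperbolic_hypX_hypY, if_true]
      | cast j =>
        simp only [hxs_last, hys_cast, prod_hyperbolic_hypX_inl, (Fin.castSucc_lt_last j).ne',
          if_false]
    | cast i =>
      induction j using Fin.lastCases with
      | last =>
        simp only [hxs_cast, hys_last, prod_hyperbolic_inl_hypY, (Fin.castSucc_lt_last i).ne,
          if_false]
      | cast j =>
        simp only [hxs_cast, hys_cast, hvv, hyperbolicForm_single_zero_single_one, Fin.castSucc_inj]
  have hxx₀ : ∀ j, Q.prod hyperbolicForm (xs j) ((g.symm (Θ₁ (e₀, 0))), 0) = 0 := by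
    intro j
    induction j using Fin.lastCases with
    | last => simp only [hxs_last, prod_hyperbolic_hypX_inl]
    | cast j => simp only [hxs_cast, hB.eq _ (g.symm (Θ₁ (e₀, 0)), 0), hspv]
  have hxy₀ : ∀ j, Q.prod hyperbolicForm (xs j) ((g.symm (Θ₁ (f₀, 0))), 0) = 0 := by
    intro j
    induction j using Fin.lastCases with
    | last => simp only [hxs_last, prod_hyperbolic_hypX_inl]
    | cast j => simp only [hxs_cast, hB.eq _ (g.symm (Θ₁ (f₀, 0)), 0), hspv]
  have hyx₀ : ∀ j, Q.prod hyperbolicForm (ys j) ((g.symm (Θ₁ (e₀, 0))), 0) = 0 := by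
    intro j
    induction j using Fin.lastCases with
    | last => simp only [hys_last, prod_hyperbolic_hypY_inl]
    | cast j => simp only [hys_cast, hB.eq _ (g.symm (Θ₁ (e₀, 0)), 0), hspv]
  have hyy₀ : ∀ j, Q.prod hyperbolicForm (ys j) ((g.symm (Θ₁ (f₀, 0))), 0) = 0 := by
    intro j
    induction j using Fin.lastCases with
    | last => simp only [hys_last, prod_hyperbolic_hypY_inl]
    | cast j => simp only [hys_cast, hB.eq _ (g.symm (Θ₁ (f₀, 0)), 0), hspv]
  -- the `N`-side hyperbolic frame, pulled back to `Q ⊕ H` along `Θ`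
  have hframe : ∀ (a b : Fin 2) (i j : Fin (k + 2)),
      Q⟦μ₂⟧ (ΘN (0, Pi.single i (Pi.single a 1))) (ΘN (0, Pi.single j (Pi.single b 1))) =
        if i = j then hyperbolicForm (Pi.single a 1 : Fin 2 → ℤ) (Pi.single b 1) else 0 := by
    intro a b i j
    simp only [hN4, LinearMap.map_zero₂, zero_add, sum_hyperbolicForm_single_single]
  let u : Fin (k + 2) → _ × (Fin 2 → ℤ) := fun l => Θ.symm (ΘN (0, Pi.single l (Pi.single 0 1)))
  let u' : Fin (k + 2) → _ × (Fin 2 → ℤ) := fun l => Θ.symm (ΘN (0, Pi.single l (Pi.single 1 1)))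
  have hu : ∀ i j, Q.prod hyperbolicForm (u i) (u j) = 0 := fun i j => by
    change Q.prod hyperbolicForm (Θ.symm _) (Θ.symm _) = 0
    simp only [LinearMap.BilinForm.IsometryEquiv.map_app, hframe, hyperbolicForm_single_zero_self,
      ite_self]
  have hu' : ∀ i j, Q.prod hyperbolicForm (u' i) (u' j) = 0 := fun i j => by
    change Q.prod hyperbolicForm (Θ.symm _) (Θ.symm _) = 0
    simp only [LinearMap.BilinForm.IsometryEquiv.map_app, hframe, hyperbolicForm_single_one_self,
      ite_self]
  have huu' : ∀ i j, Q.prod hyperbolicForm (u i) (u' j) = if i = j then 1 else 0 := fun i j => by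
    change Q.prod hyperbolicForm (Θ.symm _) (Θ.symm _) = _
    simp only [LinearMap.BilinForm.IsometryEquiv.map_app, hframe,
      hyperbolicForm_single_zero_single_one]
  -- the word `φ` in the generators agreeing with `Θ⁻¹ A Θ` on the frame, and `A' = Θ φ Θ⁻¹`
  obtain ⟨φw, hφw, hφwu⟩ := exists_isWordIn_wallGenerators_apply_eq_of_frame hQ' h₀ hxx hyy hxy
    hxx₀ hxy₀ hyx₀ hyy₀ (Θ.trans (A.trans Θ.symm)) u u' hu hu' huu'
  have hreal : IsRealisedByDiffeomorph μ₂ (Θ.symm.trans (φw.trans Θ)) :=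
    isRealisedByDiffeomorph_conj_of_isWordIn μ₂ hQ' Θ hSΘ hφw
  have hA'' : ∀ l : Fin (k + 2), (Θ.symm.trans (φw.trans Θ)) (ΘN (0, Pi.single l (Pi.single 0 1))) =
      A (ΘN (0, Pi.single l (Pi.single 0 1))) := by
    intro l
    change Θ (φw (u l)) = _
    simp only [hφwu, LinearMap.BilinForm.IsometryEquiv.trans_apply]
    change Θ (Θ.symm (A (Θ (Θ.symm _)))) = _
    simp only [LinearMap.BilinForm.IsometryEquiv.apply_symm_apply]
  have hAδ : ∀ j l : Fin (k + 2),
      Q⟦μ₂⟧ (ΘM (0, Pi.single j (Pi.single 0 1)))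
        ((Θ.symm.trans (φw.trans Θ)) (ΘN (0, Pi.single l (Pi.single 0 1)))) =
        if j = l then 1 else 0 :=
    fun j l =>
      (congrArg (fun v => Q⟦μ₂⟧ (ΘM (0, Pi.single j (Pi.single 0 1))) v) (hA'' l)).trans (hA j l)
  -- Kirby's regluing
  exact isHCobordant_of_regluingData μ₂ EM hEMsc hEMepi bM
    (fun j => ΘM (0, Pi.single j (Pi.single 0 1))) εM hM1 hM2 hM3 hεM EN hENsc hENepi bN
    (fun j => ΘN (0, Pi.single j (Pi.single 0 1))) εN hN1 hN2 hN3 hεN _ hAδ hreal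

end Main

/-! ### §4 Wall's Theorem 2 for cores with a hyperbolic plane, from (R) and the common stabilisation -/

section Corollaries

variable {M N : Type} [TopologicalSpace M] [T2Space M] [SecondCountableTopology M]
  [ChartedSpace (𝔼 4) M] [CompactSpace M] [IsManifold (𝓡 4) ∞ M] [SimplyConnectedSpace M]
  [TopologicalSpace N] [T2Space N] [SecondCountableTopology N]
  [ChartedSpace (𝔼 4) N] [CompactSpace N] [IsManifold (𝓡 4) ∞ N] [SimplyConnectedSpace N]

/-- **Wall's Thm. 2 for a pair whose form contains a hyperbolic plane, from (R) and Kirby's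
Thm. X.3** (the common stabilisation, `exists_isStabilization_of_equivalent_intersectionForm` =
Wall's (4.1), which has the X.2-free discharge routes of `HCobordismWallSpinCase.lean`): the
analogue of `isHCobordant_of_equivalent_intersectionForm_of_kirby` (`HCobordismKirby.lean`) with
Thm. X.2 replaced by the realisation of the generators of one summand.
[cite: Kirby1989, Ch. X, proof of Thm. 1, pp. 55–56] [cite: WallJLMS1964, Thm. 2 and (4.1)] -/
theorem isHCobordant_of_realisedWallGenerators_of_thmX3
    (hR : ∀ (X : Type) [TopologicalSpace X] [T2Space X] [SecondCountableTopology X]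
      [ChartedSpace (𝔼 4) X] [CompactSpace X] [IsManifold (𝓡 4) ∞ X] [SimplyConnectedSpace X]
      (ξ : HomologicalOrientation ℤ X 4)
      (_hX : (Q⟦ξ⟧).IsIndefinite ∨ Module.finrank ℤ ↥(freeCohomology ℤ X 2) ≤ 8)
      (Y : Type) [TopologicalSpace Y] [T2Space Y] [SecondCountableTopology Y]
      [ChartedSpace (𝔼 4) Y] [CompactSpace Y] [IsManifold (𝓡 4) ∞ Y]
      (_hY : IsConnectedSum (𝓡 4) (𝓡 4) ((𝓡 2).prod (𝓡 2)) X ((𝕊 2) × (𝕊 2)) Y)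
      (υ : HomologicalOrientation ℤ Y 4) (V : Type) [AddCommGroup V] (Q : BilinForm ℤ V)
      (hQ : Q.IsSymm) (_e : Q.IsometryEquiv (Q⟦ξ⟧))
      (_Θ₀ : (Q.prod hyperbolicForm).IsometryEquiv (Q⟦υ⟧)),
      ∃ Θ : (Q.prod hyperbolicForm).IsometryEquiv (Q⟦υ⟧),
        ∀ s ∈ wallGenerators hQ, IsRealisedByDiffeomorph υ (Θ.symm.trans (s.trans Θ)))
    (h3 : exists_isStabilization_of_equivalent_intersectionForm)
    (μ : HomologicalOrientation ℤ M 4) (ν : HomologicalOrientation ℤ N 4)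
    (hQ : (Q⟦μ⟧).Equivalent (Q⟦ν⟧))
    (hcore : ∃ e f : ↥(freeCohomology ℤ M 2), Q⟦μ⟧ e e = 0 ∧ Q⟦μ⟧ f f = 0 ∧ Q⟦μ⟧ e f = 1) :
    IsHCobordant 4 M N := by
  obtain ⟨k, P, _, _, _, _, _, _, hM, hN⟩ := h3 M N μ ν hQ
  exact isHCobordant_of_isStabilization_of_realisedWallGenerators hR μ ν hQ hcore hM hN

/-- **Wall's Thm. 2 for ODD forms containing a hyperbolic plane (`⟨1⟩ ⊕ ⟨-1⟩ ⊕ ⟨±1⟩ ⊕ ⋯`), from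
(R) and Thom's theorem** (`isOrientedBordant_of_signature_eq`): the common stabilisation is
`exists_isStabilization_of_equivalent_intersectionForm_of_not_isEven` (`HCobordismWallParity.lean`,
Kirby p. 56, proved modulo Thom), so in the odd case NOTHING of Thm. X.2 beyond the realisation of
the generators of one summand is used — the form in which the Akhmedov–Park frontier
(`Literature/Barriers/SmoothPoincare4/SmallExoticaFrontierOddForms.lean`, form `⟨1⟩ ⊕ 2⟨-1⟩`)
consumes Wall's theorem. [cite: WallJLMS1964, Thm. 2 (p. 141)]
[cite: Kirby1989, Ch. X, proof of Thm. 1, pp. 55–56] -/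
theorem isHCobordant_of_equivalent_intersectionForm_of_not_isEven_of_realisedWallGenerators
    (hR : ∀ (X : Type) [TopologicalSpace X] [T2Space X] [SecondCountableTopology X]
      [ChartedSpace (𝔼 4) X] [CompactSpace X] [IsManifold (𝓡 4) ∞ X] [SimplyConnectedSpace X]
      (ξ : HomologicalOrientation ℤ X 4)
      (_hX : (Q⟦ξ⟧).IsIndefinite ∨ Module.finrank ℤ ↥(freeCohomology ℤ X 2) ≤ 8)
      (Y : Type) [TopologicalSpace Y] [T2Space Y] [SecondCountableTopology Y]
      [ChartedSpace (𝔼 4) Y] [CompactSpace Y] [IsManifold (𝓡 4) ∞ Y]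
      (_hY : IsConnectedSum (𝓡 4) (𝓡 4) ((𝓡 2).prod (𝓡 2)) X ((𝕊 2) × (𝕊 2)) Y)
      (υ : HomologicalOrientation ℤ Y 4) (V : Type) [AddCommGroup V] (Q : BilinForm ℤ V)
      (hQ : Q.IsSymm) (_e : Q.IsometryEquiv (Q⟦ξ⟧))
      (_Θ₀ : (Q.prod hyperbolicForm).IsometryEquiv (Q⟦υ⟧)),
      ∃ Θ : (Q.prod hyperbolicForm).IsometryEquiv (Q⟦υ⟧),
        ∀ s ∈ wallGenerators hQ, IsRealisedByDiffeomorph υ (Θ.symm.trans (s.trans Θ)))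
    (h2 : isOrientedBordant_of_signature_eq.{0})
    (μ : HomologicalOrientation ℤ M 4) (ν : HomologicalOrientation ℤ N 4)
    (hQ : (Q⟦μ⟧).Equivalent (Q⟦ν⟧)) (hodd : ¬ (Q⟦μ⟧).IsEven)
    (hcore : ∃ e f : ↥(freeCohomology ℤ M 2), Q⟦μ⟧ e e = 0 ∧ Q⟦μ⟧ f f = 0 ∧ Q⟦μ⟧ e f = 1) :
    IsHCobordant 4 M N := by
  obtain ⟨k, P, _, _, _, _, _, _, hM, hN⟩ :=
    exists_isStabilization_of_equivalent_intersectionForm_of_not_isEven h2 μ ν hQ hodd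
  exact isHCobordant_of_isStabilization_of_realisedWallGenerators hR μ ν hQ hcore hM hN

/-- **Wall's Thm. 2 for forms containing a hyperbolic plane, from (R), Thom's theorem and the spin
bordism step for even forms** (`h3`, Kirby p. 55 — the even reading of
`HCobordismWallSpinCase.lean`): the common stabilisation is
`exists_isStabilization_of_equivalent_intersectionForm_of_evenBordism`. For even forms the
hyperbolic plane is automatic as soon as the form is indefinite (classification), but that is not
used: the pair is a hypothesis. [cite: WallJLMS1964, Thm. 2 (p. 141)]
[cite: Kirby1989, Ch. X, proof of Thm. 1 (p. 55), Ch. II Lemma 4.1 (p. 23)] -/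
theorem isHCobordant_of_equivalent_intersectionForm_of_evenBordism_of_realisedWallGenerators
    (hR : ∀ (X : Type) [TopologicalSpace X] [T2Space X] [SecondCountableTopology X]
      [ChartedSpace (𝔼 4) X] [CompactSpace X] [IsManifold (𝓡 4) ∞ X] [SimplyConnectedSpace X]
      (ξ : HomologicalOrientation ℤ X 4)
      (_hX : (Q⟦ξ⟧).IsIndefinite ∨ Module.finrank ℤ ↥(freeCohomology ℤ X 2) ≤ 8)
      (Y : Type) [TopologicalSpace Y] [T2Space Y] [SecondCountableTopology Y]
      [ChartedSpace (𝔼 4) Y] [CompactSpace Y] [IsManifold (𝓡 4) ∞ Y]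
      (_hY : IsConnectedSum (𝓡 4) (𝓡 4) ((𝓡 2).prod (𝓡 2)) X ((𝕊 2) × (𝕊 2)) Y)
      (υ : HomologicalOrientation ℤ Y 4) (V : Type) [AddCommGroup V] (Q : BilinForm ℤ V)
      (hQ : Q.IsSymm) (_e : Q.IsometryEquiv (Q⟦ξ⟧))
      (_Θ₀ : (Q.prod hyperbolicForm).IsometryEquiv (Q⟦υ⟧)),
      ∃ Θ : (Q.prod hyperbolicForm).IsometryEquiv (Q⟦υ⟧),
        ∀ s ∈ wallGenerators hQ, IsRealisedByDiffeomorph υ (Θ.symm.trans (s.trans Θ)))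
    (h2 : isOrientedBordant_of_signature_eq.{0})
    (h3 : ∀ (M N : Type) [TopologicalSpace M] [T2Space M] [SecondCountableTopology M]
      [ChartedSpace (𝔼 4) M] [CompactSpace M] [IsManifold (𝓡 4) ∞ M] [SimplyConnectedSpace M]
      [TopologicalSpace N] [T2Space N] [SecondCountableTopology N]
      [ChartedSpace (𝔼 4) N] [CompactSpace N] [IsManifold (𝓡 4) ∞ N] [SimplyConnectedSpace N]
      (μ : HomologicalOrientation ℤ M 4) (ν : HomologicalOrientation ℤ N 4),
      (Q⟦μ⟧).IsEven → (Q⟦ν⟧).IsEven → μ.signature = ν.signature →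
      ∃ c : Cobordism 4 M N, SimplyConnectedSpace c.W ∧ IsSpin (𝓡∂ (4 + 1)) c.W)
    (μ : HomologicalOrientation ℤ M 4) (ν : HomologicalOrientation ℤ N 4)
    (hQ : (Q⟦μ⟧).Equivalent (Q⟦ν⟧))
    (hcore : ∃ e f : ↥(freeCohomology ℤ M 2), Q⟦μ⟧ e e = 0 ∧ Q⟦μ⟧ f f = 0 ∧ Q⟦μ⟧ e f = 1) :
    IsHCobordant 4 M N :=
  isHCobordant_of_realisedWallGenerators_of_thmX3 hR
    (exists_isStabilization_of_equivalent_intersectionForm_of_evenBordism h2 h3) μ ν hQ hcore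

end Corollaries

end Literature.Topology.FourManifolds

end
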